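import Summits.Ventures.PercRepro.C041TriDomExcessWeighted

/-!
# ROW C-041 — THE WEIGHTED EXCESS AT `p = ½` IS THE COUNT: consistency of the two theories
(p6, gen 42; P6-TWOEXIT-LEAN.md §53 ADDENDUM 6)

At the fair probabilities `w = ½` every colouring has the weight `(½)^|E|` (`cwt_half`), so the weighted symmetrised
excess with forced-red edges is the forced count of `C041TriDomExcessForced` divided by `2^|E|` (`esymW_half`), and
THEOREM (FORCED RED) `esymF_nonneg` is the case `w = ½` of `esymW_nonneg` (`esymF_nonneg'`) — the two theories agree
where they meet, and the fair count `esym` of `C041TriDomExcessRec` is the case `R = ∅` (`esym_eq_esymW_half`).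
-/

namespace PercRepro

namespace ZoneZ

namespace MultiExit

open ZoneData Finset

variable {V₁ E₁ U₁ U₂ : Type} (Z₁ : ZoneData V₁ E₁ U₁ U₂) (u u' a₁ : V₁)

variable [Fintype E₁] [DecidableEq E₁]

omit [DecidableEq E₁] in
/-- At the fair probabilities every colouring has the weight `(½)^|E|`. -/
theorem cwt_half (ω : E₁ → Bool) : cwt (fun _ => (1 / 2 : ℚ)) ω = (1 / 2) ^ Fintype.card E₁ := by
  unfold cwt
  have h : ∀ e, wt (1 / 2 : ℚ) (ω e) = 1 / 2 := by
    intro e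
    cases ω e <;> norm_num [wt]
  simp only [h, Finset.prod_const, Finset.card_univ]

/-- The weighted symmetrised excess at `w = ½` is the forced count divided by `2^|E|`. -/
theorem esymW_half (R : E₁ → Prop) (st : E₁ → EStat) :
    esymW Z₁ u u' a₁ R st (fun _ => (1 / 2 : ℚ)) = (1 / 2) ^ Fintype.card E₁ * (esymF Z₁ u u' a₁ R st : ℚ) := by
  unfold esymW esymF
  simp only [cwt_half, ← Finset.mul_sum, Int.cast_sum]

/-- THEOREM (FORCED RED) as the case `w = ½` of the weighted theorem. -/
theorem esymF_nonneg' (R : E₁ → Prop) (st : E₁ → EStat) : 0 ≤ esymF Z₁ u u' a₁ R st := by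
  have h := esymW_nonneg Z₁ u u' a₁ R st (fun _ => (1 / 2 : ℚ)) (fun _ => by norm_num)
  rw [esymW_half] at h
  have hp : (0 : ℚ) < (1 / 2) ^ Fintype.card E₁ := by positivity
  have : (0 : ℚ) ≤ (esymF Z₁ u u' a₁ R st : ℚ) := by
    by_contra hneg
    have := mul_neg_of_pos_of_neg hp (lt_of_not_ge hneg)
    linarith
  exact_mod_cast this

/-- The fair symmetrised excess of `C041TriDomExcessRec` is the forced count without forced edges. -/
theorem esym_eq_esymF_false (st : E₁ → EStat) : esym Z₁ u u' a₁ st = esymF Z₁ u u' a₁ (fun _ => False) st := by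
  unfold esym esymF
  simp only [rsigF_false]

/-- The fair symmetrised excess is the weighted excess at `w = ½` (without forced edges), up to the factor `2^|E|`. -/
theorem esym_eq_esymW_half (st : E₁ → EStat) :
    (esym Z₁ u u' a₁ st : ℚ) = 2 ^ Fintype.card E₁ * esymW Z₁ u u' a₁ (fun _ => False) st (fun _ => (1 / 2 : ℚ)) := by
  rw [esymW_half, esym_eq_esymF_false, ← mul_assoc, ← mul_pow]
  norm_num

end MultiExit

end ZoneZ

end PercRepro
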